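import Literature.AlgebraicGeometry.Surfaces.K3Surface
import Literature.AlgebraicGeometry.HodgeTheory.GysinProjectionNonvanishing
import Literature.AlgebraicGeometry.HodgeTheory.CrossProductTopClass
import HarnessLib

/-!
# Route NikulinTwinTransport · crux `TwinSimilitudeAlgebraic` (stmt-HodgeConjecture-13674) —
# stub `stub_topPushProportional` of line `hyperkaehler-nikulin-anchors` (reshape r6, stub T1)

**The two top-degree push-forwards of a product are proportional.**  For smooth projective complex
varieties `X`, `Z` of dimensions `l`, `n`, the product `T = X ⊗ Z` (dimension `l + n`) and non-zero
classes `pg ∈ H^{2l}(X(ℂ); ℂ)`, `p ∈ H^{2n}(Z(ℂ); ℂ)`, there is a NON-ZERO scalar `κ` with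

  `fst₊ W = a · pg ⟹ snd₊ W = (κ a) · p`   for every top class `W ∈ H^{2(l+n)}(T(ℂ); ℂ)`

(`topPush_proportional`).  Proof: `H^{2(l+n)}(T(ℂ))` is a line (`exists_eq_smul_of_top`) spanned
by the cross product `W₁ = fst^* pg ∪ snd^* p`; by the projection formula (`complexGysin_cup`)
`fst₊ W₁ = pg ∪ fst₊ snd^* p = ε · pg` and `snd₊ W₁ = p ∪ snd₊ fst^* pg = ε′ · p`, the degree-`0`
classes `fst₊ snd^* p = ε · 1`, `snd₊ fst^* pg = ε′ · 1` (`exists_eq_smul_one`) being non-zero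
(`complexGysin_fst_map_snd_ne_zero`, `complexGysin_snd_map_fst_ne_zero`); put `κ := ε′ ε⁻¹`.
The registered stub `stub_topPushProportional` is the case of two projective K3 surfaces
`X = Sg`, `Z = S` (`l = n = 2`), the one TOPOLOGICAL input of the transpose-anchor step of the line.

## References

* [FultonYoungTableaux1997] W. Fulton, Young Tableaux, CUP 1997, Appendix B §B.1 (5)–(7).
* [HatcherAT2002] A. Hatcher, Algebraic Topology, CUP 2002, §3.2 Thm. 3.15, §3.3 Thm. 3.26,
  Thm. 3.30.
-/

noncomputable section

set_option linter.dupNamespace false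

open CategoryTheory MonoidalCategory
open scoped Manifold Matrix
open Literature.AlgebraicGeometry.Motives Literature.AlgebraicGeometry.HodgeTheory
open Literature.AlgebraicGeometry.Surfaces Literature.Geometry.Kaehler
open Literature.AlgebraicTopology.SingularHomology

namespace Summit.HodgeConjecture.HodgeConjecture.Theorems.NikulinTwinTransport

/-! ## The general statement: smooth projective `X`, `Z` of dimensions `l`, `n` -/

/-- **The two top-degree push-forwards `fst₊ : H^{2(l+n)}((X ⊗ Z)(ℂ)) → H^{2l}(X(ℂ))` and
`snd₊ : H^{2(l+n)}((X ⊗ Z)(ℂ)) → H^{2n}(Z(ℂ))` are proportional with a non-zero constant**, read in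
given non-zero top classes `pg` of `X(ℂ)` and `p` of `Z(ℂ)`: there is `κ ≠ 0` with
`fst₊ W = a · pg ⟹ snd₊ W = (κ a) · p` for all top classes `W`.  The top cohomology of
`(X ⊗ Z)(ℂ)` is the line spanned by `fst^* pg ∪ snd^* p` (`exists_eq_smul_of_top`), whose two
push-forwards are `ε · pg`, `ε′ · p` with `ε, ε′ ≠ 0` (projection formula `complexGysin_cup`,
`exists_eq_smul_one`, `complexGysin_fst_map_snd_ne_zero`, `complexGysin_snd_map_fst_ne_zero`);
`κ := ε′ ε⁻¹`. [cite: FultonYoungTableaux1997, Appendix B §B.1 (5)–(7)]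
[cite: HatcherAT2002, §3.3 Thm. 3.26 and Thm. 3.30] -/
theorem topPush_proportional (μ : OrientationFamily) (hμ : μ.HasPoincareDuality) {l n : ℕ}
    {X Z : SchemeOver ℂ} (hX : IsSmoothProjective l X) (hZ : IsSmoothProjective n Z)
    {pg : complexBetti X (2 * l)} {p : complexBetti Z (2 * n)} (hpg : pg ≠ 0) (hp : p ≠ 0)
    (h₁ : 2 * (l + n) + 2 * l = 2 * l + 2 * (l + n))
    (h₂ : 2 * (l + n) + 2 * n = 2 * n + 2 * (l + n)) :
    ∃ κ : ℂ, κ ≠ 0 ∧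
      ∀ (W : complexBetti (X ⊗ Z) (2 * (l + n))) (a : ℂ),
        complexGysin μ (IsSmoothProjective.tensor_holds hX hZ) hX
            (SemiCartesianMonoidalCategory.fst X Z) h₁ W = a • pg →
          complexGysin μ (IsSmoothProjective.tensor_holds hX hZ) hZ
            (SemiCartesianMonoidalCategory.snd X Z) h₂ W = (κ * a) • p := by
  have hT := IsSmoothProjective.tensor_holds hX hZ
  -- the two degree-`0` fibre integrals `fst₊ snd^* p = ε • 1`, `snd₊ fst^* pg = ε' • 1`
  set g := complexGysin μ hT hX (SemiCartesianMonoidalCategory.fst X Z)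
      (show 2 * n + 2 * l = 0 + 2 * (l + n) by omega)
      (complexBetti.map (SemiCartesianMonoidalCategory.snd X Z) (2 * n) p) with hgdef
  set g' := complexGysin μ hT hZ (SemiCartesianMonoidalCategory.snd X Z)
      (show 2 * l + 2 * n = 0 + 2 * (l + n) by omega)
      (complexBetti.map (SemiCartesianMonoidalCategory.fst X Z) (2 * l) pg) with hg'def
  have hg : g ≠ 0 := complexGysin_fst_map_snd_ne_zero μ hX hZ hp
  have hg' : g' ≠ 0 := complexGysin_snd_map_fst_ne_zero μ hX hZ hpg
  obtain ⟨ε, hε⟩ := exists_eq_smul_one μ hX g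
  obtain ⟨ε', hε'⟩ := exists_eq_smul_one μ hZ g'
  have hε0 : ε ≠ 0 := fun h0 ↦ hg (by rw [hε, h0, zero_smul])
  have hε'0 : ε' ≠ 0 := fun h0 ↦ hg' (by rw [hε', h0, zero_smul])
  -- the cross product `W₁ = fst^* pg ∪ snd^* p` and its two push-forwards
  set W₁ : complexBetti (X ⊗ Z) (2 * (l + n)) :=
    cupProduct (show 2 * l + 2 * n = 2 * (l + n) by omega)
      (complexBetti.map (SemiCartesianMonoidalCategory.fst X Z) (2 * l) pg)
      (complexBetti.map (SemiCartesianMonoidalCategory.snd X Z) (2 * n) p) with hW₁def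
  have hfst : complexGysin μ hT hX (SemiCartesianMonoidalCategory.fst X Z) h₁ W₁ = ε • pg := by
    rw [hW₁def, complexGysin_cup hμ hT hX (SemiCartesianMonoidalCategory.fst X Z)
      (show 2 * l + 2 * n = 2 * (l + n) by omega) h₁
      (show 2 * n + 2 * l = 0 + 2 * (l + n) by omega) (Nat.add_zero _) pg, ← hgdef, hε, map_smul,
      cupProduct_one]
  have hW₁' : W₁ = cupProduct (show 2 * n + 2 * l = 2 * (l + n) by omega)
      (complexBetti.map (SemiCartesianMonoidalCategory.snd X Z) (2 * n) p)
      (complexBetti.map (SemiCartesianMonoidalCategory.fst X Z) (2 * l) pg) := by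
    have hsign : ((-1 : ℂ) ^ (2 * l * (2 * n))) = 1 := Even.neg_one_pow ⟨l * (2 * n), by ring⟩
    rw [hW₁def, cupProduct_gradedComm_holds ℂ _ _ (show 2 * n + 2 * l = 2 * (l + n) by omega),
      hsign, one_smul]
  have hsnd : complexGysin μ hT hZ (SemiCartesianMonoidalCategory.snd X Z) h₂ W₁ = ε' • p := by
    rw [hW₁', complexGysin_cup hμ hT hZ (SemiCartesianMonoidalCategory.snd X Z)
      (show 2 * n + 2 * l = 2 * (l + n) by omega) h₂
      (show 2 * l + 2 * n = 0 + 2 * (l + n) by omega) (Nat.add_zero _) p, ← hg'def, hε', map_smul,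
      cupProduct_one]
  have hW₁0 : W₁ ≠ 0 := by
    intro h0
    rw [h0, map_zero] at hfst
    exact hpg ((smul_eq_zero.mp hfst.symm).resolve_left hε0)
  -- `κ := ε' ε⁻¹`; every top class is `t • W₁`
  refine ⟨ε' * ε⁻¹, mul_ne_zero hε'0 (inv_ne_zero hε0), fun W a ha ↦ ?_⟩
  obtain ⟨t, rfl⟩ := exists_eq_smul_of_top μ hT hW₁0 W
  rw [map_smul, hfst, smul_smul] at ha
  have hta : t * ε = a := smul_left_injective ℂ hpg ha
  rw [map_smul, hsnd, smul_smul, ← hta]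
  congr 1
  field_simp

/-! ## The stub -/

/-- **T1 — `TopPushProportional` (TOPOLOGY of the fourfold `Σ ⊗ S`)**, registered stub
`stub_topPushProportional` of line `hyperkaehler-nikulin-anchors`.  For projective K3 surfaces
`S, Σ = Sg` and non-zero `p ∈ H⁴(S(ℂ))`, `pg ∈ H⁴(Σ(ℂ))` there is `κ ≠ 0` with
`fst₊ W = a · pg ⟹ snd₊ W = κ a · p` for every top class `W ∈ H⁸((Σ ⊗ S)(ℂ); ℂ)`: `H⁸` is a line
(`exists_eq_smul_of_top`) spanned by `W₁ = fst^* pg ∪ snd^* p`, and `fst₊ W₁ = ε · pg`,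
`snd₊ W₁ = ε′ · p` with `ε, ε′ ≠ 0` (projection formula, `complexGysin_fst_map_snd_ne_zero`,
`complexGysin_snd_map_fst_ne_zero`, `exists_eq_smul_one`); `κ := ε′/ε` (`topPush_proportional` at
`l = n = 2`). [cite: FultonYoungTableaux1997, Appendix B §B.1 (5)–(7)]
[cite: HatcherAT2002, §3.3 Thm. 3.26 and Thm. 3.30] -/
theorem stub_topPushProportional :
    ∀ (μ : OrientationFamily), μ.HasPoincareDuality →
      ∀ (S Sg : SchemeOver ℂ) (hS : IsK3Surface S) (hSg : IsK3Surface Sg)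
        (p : complexBetti S (2 * 2)) (pg : complexBetti Sg (2 * 2)), p ≠ 0 → pg ≠ 0 →
        ∃ κ : ℂ, κ ≠ 0 ∧
          ∀ (W : complexBetti (MonoidalCategoryStruct.tensorObj Sg S) (2 * (2 + 2))) (a : ℂ),
            complexGysin μ
                (IsSmoothProjective.tensor_holds (IsK3Surface.isSmoothProjective hSg)
                  (IsK3Surface.isSmoothProjective hS))
                (IsK3Surface.isSmoothProjective hSg) (SemiCartesianMonoidalCategory.fst Sg S)
                (rfl : 2 * (2 + 2) + 2 * 2 = 2 * 2 + 2 * (2 + 2)) W = a • pg →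
              complexGysin μ
                (IsSmoothProjective.tensor_holds (IsK3Surface.isSmoothProjective hSg)
                  (IsK3Surface.isSmoothProjective hS))
                (IsK3Surface.isSmoothProjective hS) (SemiCartesianMonoidalCategory.snd Sg S)
                (rfl : 2 * (2 + 2) + 2 * 2 = 2 * 2 + 2 * (2 + 2)) W = (κ * a) • p :=
  fun μ hμ _S _Sg hS hSg _p _pg hp hpg ↦
    topPush_proportional μ hμ (IsK3Surface.isSmoothProjective hSg)
      (IsK3Surface.isSmoothProjective hS) hpg hp _ _

end Summit.HodgeConjecture.HodgeConjecture.Theorems.NikulinTwinTransport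

end
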